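import Summits.BirchSwinnertonDyer.Rank1Residual.X11a.SelmerCompanionTateLine
import HarnessLib

/-!
# Route (3e) SELMER COMPANION, XVIII-a: file VIII-a for a FIXED Tate datum — at a multiplicative
# place, every Selmer class is valued in the Tate line of ONE parametrisation modulo a coboundary
# (class X11a = N7; cell `b2b-bsdres`, unit `b2b-bsdres-x11a`, gen 28)

HONEST FRAMING (run/shared/lean/b2b/bsd-rank1-residual/, verbatim in every file): the goal of the
cell is to DELETE the COMBINATION-SHAPED residual classes of the Birch–Swinnerton-Dyer formula for
ALL analytic-rank `≤ 1` elliptic curves over `ℚ` — "full BSD formula for every rank `≤ 1` curve in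
class `C`" assembled STRICTLY from published theorems — so that the rank-`≤ 1` remainder becomes
exactly the CONSTRUCTION-SHAPED classes, which are TYPED (missing-input `Prop`s), NOT attempted.
This is not "finishing BSD". CLASS-OWNERS.md: research routes; NO CLAIM BEYOND STATED CLASSES.
THEOREMS ONLY; nothing booked; no label moves. CONDITIONAL on the PUBLISHED named fact
`Silverman1994_thmV53_corV54_tateUniformisation` (A41, `hU`) where it is a hypothesis.

## The lemma (`exists_cocycle_eq_tate_rootOfUnity_of_datum`)

`E = W` over a number field `K`, `p` odd, `v` ANY finite place of multiplicative reduction (split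
or not, `v ∣ p` allowed), `φ : Γ_K → E[p]` a continuous cocycle whose class is Selmer at `v`. Then,
with `(q, t = √γ, Ψ)` the twisted Tate parametrisation of A41 at `v` (returned together with its
kernel `q^ℤ` and its twisted equivariance), there are `p`-th roots of unity `ζ_σ ∈ K̄_v`
(`σ ∈ Γ_{K_v}`) and a `p`-torsion point `T ∈ E(K̄_v)` with

  `φ(res σ) = Ψ(ζ_σ) + (σT - T)`   in `E(K̄_v)`, for every `σ ∈ Γ_{K_v}`:

modulo a coboundary, the restriction of `φ` to `Γ_{K_v}` takes values in the TATE LINE `Ψ(μ_p)`.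
File VIII-a (gen 27) packages this together with the EXISTENCE of the datum (one `∃` per class);
the comparison INDEX at `p` (file XVIII-b) needs the conclusion for ALL Selmer classes with respect
to ONE datum `(q, t, Ψ)`, so this file re-proves it with the datum and its four properties (kernel
`q^ℤ`, twisted equivariance, rational points à la Cor. V.5.4, `|q|_v < 1`) as HYPOTHESES — any datum
delivered by the named fact A41 qualifies. The proof is that of file VIII-a verbatim.
This is the algebra of file IV (`X11a/SelmerCompanionNonsplit.lean`, Silverman *ATAEC* V.5.3/5.4:
`φ(res σ) = σa' - a'`, `p(p+1)a' = Ψ(u')` with `u'` twist-invariant by `exists_twistInvariant_lift`,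
`w₀^p = u'`, `ζ_σ = (σw₀)^{ε σ}/w₀`, `T = (p+1)a' - Ψ(w₀)`), isolated as a statement because it is
the E-side input of lemma L-p-ns (file VIII-b, `X11a/SelmerCompanionAtP.lean`) at `v ∣ p`, where
the inertia argument of file IV is replaced by the comparison with the good partner's kernel of
reduction.

References: [SilvermanATAEC1994] V.5.2 (c), 5.3, 5.4; HOME/b2b-bsdres-x11a/REPORT-g27.md.
-/

set_option autoImplicit false

noncomputable section

open scoped Classical NNReal

open WeierstrassCurve Literature.NumberTheory.EllipticCurves
  Literature.NumberTheory.GaloisRepresentations Field NumberField IsDedekindDomain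
  Literature.NumberTheory.EllipticCurves.Rank1Residual
  Literature.NumberTheory.EllipticCurves.Rank1Residual.Typed

namespace Summit.BirchSwinnertonDyer.Rank1Residual.X11a.SelmerCompanion

variable {K : Type} [Field K] [NumberField K] (W : WeierstrassCurve K) [W.IsElliptic]
  {p : ℕ} [hp : Fact p.Prime] (v : HeightOneSpectrum (𝓞 K))

omit [W.IsElliptic] in
/-- **File VIII-a for a fixed datum.** For `p` odd and a Tate datum `(q, t, Φ)` of `E = W` at
`v` with the properties delivered by A41 (`hq0`, `ht2`, kernel `hker`, twisted equivariance
`hequiv₀`, rational points `hrat`), every continuous cocycle `φ : Γ_K → E[p]` whose class is Selmer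
at `v` satisfies `φ(res σ) = Φ(ζ_σ) + (σT − T)` for `p`-th roots of unity `ζ_σ` and a `p`-torsion
point `T`. [cite: SilvermanATAEC1994, Ch. V Lemma 5.2 (c), Thm. 5.3, Cor. 5.4] -/
theorem exists_cocycle_eq_tate_rootOfUnity_of_datum (hp2 : p ≠ 2)
    {q : v.adicCompletion K} {t : AlgebraicClosure (v.adicCompletion K)}
    {Φ : Additive (AlgebraicClosure (v.adicCompletion K))ˣ →+ localPoints W (v.adicCompletion K)}
    (hq0 : q ≠ 0)
    (ht2 : t ^ 2 = algebraMap (v.adicCompletion K) (AlgebraicClosure (v.adicCompletion K))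
        (algebraMap K (v.adicCompletion K) (-(W.c₄ / W.c₆))))
    (hker : ∀ u : (AlgebraicClosure (v.adicCompletion K))ˣ, Φ (Additive.ofMul u) = 0 ↔
        ∃ n : ℤ, (u : AlgebraicClosure (v.adicCompletion K)) =
          algebraMap (v.adicCompletion K) (AlgebraicClosure (v.adicCompletion K)) q ^ n)
    (hequiv₀ : ∀ (σ : absoluteGaloisGroup (v.adicCompletion K)) (u : (AlgebraicClosure (v.adicCompletion K))ˣ),
        σ • Φ (Additive.ofMul u) =
          (if Field.absoluteGaloisGroup.toAlgEquiv (v.adicCompletion K) σ t = t then (1 : ℤ)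
            else -1) •
          Φ (Additive.ofMul (Units.map
            (Field.absoluteGaloisGroup.toAlgEquiv (v.adicCompletion K) σ :
              AlgebraicClosure (v.adicCompletion K) →* AlgebraicClosure (v.adicCompletion K)) u)))
    (hrat : ∀ P : localPoints W (v.adicCompletion K),
        (∀ σ : absoluteGaloisGroup (v.adicCompletion K), σ • P = P) →
        ∃ u : (AlgebraicClosure (v.adicCompletion K))ˣ,
          (∀ σ : absoluteGaloisGroup (v.adicCompletion K),
            Field.absoluteGaloisGroup.toAlgEquiv (v.adicCompletion K) σ t = t →
            Units.map (Field.absoluteGaloisGroup.toAlgEquiv (v.adicCompletion K) σ :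
              AlgebraicClosure (v.adicCompletion K) →* AlgebraicClosure (v.adicCompletion K)) u = u) ∧
          (∀ σ : absoluteGaloisGroup (v.adicCompletion K),
            Field.absoluteGaloisGroup.toAlgEquiv (v.adicCompletion K) σ t ≠ t →
            ∃ m : ℤ, ((u * Units.map
              (Field.absoluteGaloisGroup.toAlgEquiv (v.adicCompletion K) σ :
                AlgebraicClosure (v.adicCompletion K) →* AlgebraicClosure (v.adicCompletion K)) u : (AlgebraicClosure (v.adicCompletion K))ˣ) : AlgebraicClosure (v.adicCompletion K)) =
              algebraMap (v.adicCompletion K) (AlgebraicClosure (v.adicCompletion K)) q ^ m) ∧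
          Φ (Additive.ofMul u) = P)
    (φ : contOneCocycles (discreteTopRep (absoluteGaloisGroup K) (geomTorsion W (p : ℤ))))
    (hc : oneCocycleClass _ φ ∈ selmerLocalKer W (v.adicCompletion K) (p : ℤ)) :
    ∃ (ζ : absoluteGaloisGroup (v.adicCompletion K) → (AlgebraicClosure (v.adicCompletion K))ˣ)
      (T : localPoints W (v.adicCompletion K)),
      (∀ σ, ζ σ ^ p = 1) ∧ (p : ℤ) • T = 0 ∧
      ∀ σ : absoluteGaloisGroup (v.adicCompletion K),
        pointsMap W (v.adicCompletion K)
          ((φ.1 (resGal (K := K) (v.adicCompletion K) σ) : geomTorsion W (p : ℤ)) :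
            geomPoints W) = Φ (Additive.ofMul (ζ σ)) + (σ • T - T) := by
  have hpp : p.Prime := hp.out
  haveI : NeZero p := ⟨hpp.ne_zero⟩
  obtain ⟨k₂, hk₂⟩ : ∃ k₂ : ℕ, p + 1 = 2 * k₂ := by
    obtain ⟨k, hk⟩ := hpp.odd_of_ne_two hp2
    exact ⟨k + 1, by omega⟩
  -- the sign `ε(σ)`
  obtain ⟨ε, hε_of_fix, hε_of_not⟩ : ∃ ε : (absoluteGaloisGroup (v.adicCompletion K)) → ℤ,
      (∀ σ, Field.absoluteGaloisGroup.toAlgEquiv (v.adicCompletion K) σ t = t → ε σ = 1) ∧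
        (∀ σ, Field.absoluteGaloisGroup.toAlgEquiv (v.adicCompletion K) σ t ≠ t → ε σ = -1) :=
    ⟨fun σ ↦ if Field.absoluteGaloisGroup.toAlgEquiv (v.adicCompletion K) σ t = t then 1 else -1,
      fun σ h ↦ if_pos h, fun σ h ↦ if_neg h⟩
  have hequiv : ∀ (σ : (absoluteGaloisGroup (v.adicCompletion K))) (u : (AlgebraicClosure
      (v.adicCompletion K))ˣ),
      σ • Φ (Additive.ofMul u) = (ε σ) • Φ (Additive.ofMul (Units.map
          (absoluteGaloisGroup.toAlgEquiv _ σ : AlgebraicClosure (v.adicCompletion K)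
          →* AlgebraicClosure (v.adicCompletion K)) u)) := by
    intro σ u
    rw [hequiv₀ σ u]
    by_cases h : Field.absoluteGaloisGroup.toAlgEquiv (v.adicCompletion K) σ t = t
    · rw [if_pos h, hε_of_fix σ h]
    · rw [if_neg h, hε_of_not σ h]
  have hact_pow : ∀ (σ : (absoluteGaloisGroup (v.adicCompletion K))) (x : (AlgebraicClosure
      (v.adicCompletion K))ˣ) (n : ℕ),
      (Units.map (absoluteGaloisGroup.toAlgEquiv _ σ : AlgebraicClosure (v.adicCompletion K)
          →* AlgebraicClosure (v.adicCompletion K)) (x ^ n)) ^ (ε σ) = ((Units.map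
          (absoluteGaloisGroup.toAlgEquiv _ σ : AlgebraicClosure (v.adicCompletion K)
          →* AlgebraicClosure (v.adicCompletion K)) x) ^ (ε σ)) ^ n := by
    intro σ x n
    rw [map_pow, ← zpow_natCast, ← zpow_mul, mul_comm, zpow_mul, zpow_natCast]
  -- a point `a'` trivialising the class locally; `a₁ = a' + p a'`
  rw [selmerLocalKer, oneCocycleClass_mem_resKer_iff] at hc
  obtain ⟨a', ha'⟩ := hc
  have ha'' : ∀ σ : (absoluteGaloisGroup (v.adicCompletion K)), pointsMap W (v.adicCompletion K)
      ((φ.1 (resGal (K := K) (v.adicCompletion K) σ) : geomTorsion W (p : ℤ)) :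
      geomPoints W) = σ • a' - a' := fun σ ↦ ha' σ
  have hP'fix : ∀ σ : (absoluteGaloisGroup (v.adicCompletion K)), σ • ((p : ℤ) • a') = (p : ℤ)
      • a' := by
    intro σ
    have h0 : (p : ℤ) • (σ • a' - a') = 0 := by
      rw [← ha'' σ, ← map_zsmul, (mem_geomTorsion_iff W _ _).mp (φ.1 _).2, map_zero]
    rw [W.smul_zsmul_localPoints (p : ℤ) σ a']
    rw [zsmul_sub, sub_eq_zero] at h0
    exact h0
  set a₁ : localPoints W (v.adicCompletion K) := a' + (p : ℤ) • a' with ha₁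
  have ha₁' : ∀ σ : (absoluteGaloisGroup (v.adicCompletion K)), pointsMap W (v.adicCompletion K)
      ((φ.1 (resGal (K := K) (v.adicCompletion K) σ) : geomTorsion W (p : ℤ)) :
      geomPoints W) = σ • a₁ - a₁ := by
    intro σ
    rw [ha'' σ, ha₁, smul_add, hP'fix]
    abel
  have hpa₁ : (p : ℤ) • a₁ = (p + 1 : ℕ) • ((p : ℤ) • a') := by
    rw [ha₁, zsmul_add, succ_nsmul, ← natCast_zsmul ((p : ℤ) • a') p, add_comm]
  -- `p a' = Ψ(u)`; a twist-invariant `u'` with `Ψ(u') = (p+1) p a'`; a `p`-th root `w₀`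
  obtain ⟨u, huL, huN, hu⟩ := hrat ((p : ℤ) • a') hP'fix
  obtain ⟨u', hu'inv, hu'val⟩ := W.exists_twistInvariant_lift v hq0 Φ hker ht2 ε hε_of_fix
    hε_of_not k₂ huL huN
  rw [hu, ← hk₂] at hu'val
  obtain ⟨z, hz⟩ := IsAlgClosed.exists_pow_nat_eq (u' : (AlgebraicClosure
      (v.adicCompletion K))) hpp.pos
  have hz0 : z ≠ 0 := by
    rintro rfl
    rw [zero_pow hpp.ne_zero] at hz
    exact u'.ne_zero hz.symm
  set w₀ : (AlgebraicClosure (v.adicCompletion K))ˣ := Units.mk0 z hz0 with hw₀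
  have hwp : w₀ ^ p = u' := Units.ext (by rw [Units.val_pow_eq_pow_val, hw₀, Units.val_mk0, hz])
  set R : localPoints W (v.adicCompletion K) := Φ (Additive.ofMul w₀) with hR
  have hRp : (p : ℤ) • R = (p : ℤ) • a₁ := by
    rw [hR, ← map_zsmul, ← ofMul_zpow, zpow_natCast, hwp, hu'val, hpa₁]
  set T : localPoints W (v.adicCompletion K) := a₁ - R with hT
  have hTp : (p : ℤ) • T = 0 := by rw [hT, zsmul_sub, hRp, sub_self]
  -- `ζ_σ` with `(σ w₀)^{ε σ} = ζ_σ w₀`; `ζ_σ^p = 1`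
  obtain ⟨ζf, hζf⟩ : ∃ ζf : (absoluteGaloisGroup (v.adicCompletion K)) → (AlgebraicClosure
      (v.adicCompletion K))ˣ, ∀ σ, (Units.map
      (absoluteGaloisGroup.toAlgEquiv _ σ : AlgebraicClosure (v.adicCompletion K)
      →* AlgebraicClosure (v.adicCompletion K)) w₀) ^ (ε σ) = ζf σ * w₀ :=
    ⟨fun σ ↦ (Units.map (absoluteGaloisGroup.toAlgEquiv _ σ : AlgebraicClosure
        (v.adicCompletion K) →* AlgebraicClosure (v.adicCompletion K)) w₀) ^ (ε σ) / w₀,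
        fun σ ↦ by rw [div_mul_cancel]⟩
  have hζσ : ∀ σ : (absoluteGaloisGroup (v.adicCompletion K)), (ζf σ) ^ p = 1 := by
    intro σ
    have h : ((Units.map (absoluteGaloisGroup.toAlgEquiv _ σ : AlgebraicClosure
        (v.adicCompletion K) →* AlgebraicClosure (v.adicCompletion K)) w₀) ^ (ε σ)) ^ p =
        (ζf σ * w₀) ^ p := by
      rw [hζf σ]
    rw [← hact_pow, hwp, hu'inv σ, mul_pow, hwp] at h
    exact (mul_right_cancel (by rw [one_mul]; exact h.symm)).symm.symm
  have hε_pow : ∀ σ : (absoluteGaloisGroup (v.adicCompletion K)), Φ (Additive.ofMul ((Units.map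
      (absoluteGaloisGroup.toAlgEquiv _ σ : AlgebraicClosure (v.adicCompletion K)
      →* AlgebraicClosure (v.adicCompletion K)) w₀) ^ (ε σ))) = (ε σ) • Φ (Additive.ofMul
      (Units.map (absoluteGaloisGroup.toAlgEquiv _ σ : AlgebraicClosure (v.adicCompletion K)
      →* AlgebraicClosure (v.adicCompletion K)) w₀)) := fun σ ↦ by
    rw [ofMul_zpow, map_zsmul]
  refine ⟨ζf, T, hζσ, hTp, fun σ ↦ ?_⟩
  rw [ha₁' σ, hT, smul_sub, hR, hequiv σ w₀, ← hε_pow, hζf σ, ofMul_mul, map_add Φ]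
  abel

end Summit.BirchSwinnertonDyer.Rank1Residual.X11a.SelmerCompanion

end
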